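import Mathlib.Analysis.Convolution
import Mathlib.Analysis.Normed.Group.FunctionSeries
import Literature.MathematicalPhysics.QuantumLattice.LiebWuRootDensityIdentification
import HarnessLib

/-!
# The Neumann series of Lieb–Wu's proof of Theorem 1 at `B = ∞` (existence step)

Family `hubbard`. Lieb–Wu, Physica A 321 (2003) 1, §5, prove THEOREM 1 (existence, uniqueness,
positivity of the solution of the integral equations (13)–(14) of PRL 20 (1968) 1445 for all
`0 < Q ≤ π`, `0 < B ≤ ∞`) by rewriting the `σ`-equation as eq. (S) `(1 - Ŵ)σ = R̂(Â + D̂)t ≡ ξ`,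
`Ŵ = R̂K̂(1 - B̂) + R̂ÂK̂B̂` (eq. (W)), and solving it "by iteration: `σ = (1 + Ŵ + Ŵ² + Ŵ³ + …) ξ`
(eq. (series)). This is a strongly convergent series … Moreover, since each term is a positive function,
we conclude that `σ` is a positive function as well." This file carries out the iteration at `B = ∞`
(`B̂ = 1`, `Ŵ = R̂ÂK̂`), in the ORIGINAL rapidity variable `Λ`, with the momentum integral kept over
`k ∈ [-Q, Q]` (so `(Â + D̂)t` is the image of `dk/2π` under `sin` and no change of variables is needed):
`liebWuXi U Q Λ = (1/4π) ∫_{-Q}^{Q} r(Λ - sin k) dk` (`ξ`; `R̂` has kernel `r/2`, `r = sechKernel (U/4)`),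
`liebWuW U Q h x = ½ ∫ 1_{(-a,a]}(y) (h ∗ K_{U/4})(y) r(x - y) dy` (`Ŵ`, `a = sin Q`),
`liebWuNeumannTerm U Q n = Ŵⁿ ξ`, `liebWuSigmaAt U Q = Σₙ Ŵⁿ ξ`. PROVED (`U > 0`, `0 < Q`): every term is
continuous, nonnegative, integrable, `∫ Ŵⁿξ ≤ 2⁻ⁿ ∫ ξ` ("`‖Ŵ‖ < 1`": `∫ r = ∫ K = 1`), `sup Ŵⁿ⁺¹ξ ≤ (1/U) 2⁻ⁿ ∫ξ`;
the series converges uniformly; `σ = liebWuSigmaAt U Q` is continuous, positive, integrable and solves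
**`σ = ξ + Ŵσ`** (`liebWuSigmaAt_eq_xi_add_W`). Translating the fixed point back into (13)–(14) (applying
`1 + K̂²` via the kernel identity `K² ∗ r = 2K - r` of `LiebWuHalfFilledDensities`) is left to the file that
assembles existence with `IsLiebWuDensities`. No named fact.

## References

* E. H. Lieb, F. Y. Wu, Physica A 321 (2003) 1–27 = arXiv:cond-mat/0207529, §5, proof of Theorem 1,
  eqs. (S), (R), (W), (series) (key `LiebWuPhysicaA2003`).
-/

noncomputable section

open MeasureTheory Set Real Filter intervalIntegral
open Literature.Analysis.SpecialFunctions
open scoped Convolution Topology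

namespace Literature.MathematicalPhysics.QuantumLattice

namespace LiebWuNeumann

variable {f g : ℝ → ℝ} {B : ℝ}

/-- `t ↦ f(t) g(x - t)` is integrable for `f ∈ L¹`, `g` bounded continuous. [folklore] -/
private theorem integrable_mul_sub (hf : Integrable f) (hgc : Continuous g) (hgB : ∀ y, |g y| ≤ B)
    (x : ℝ) : Integrable fun t => f t * g (x - t) :=
  hf.mul_bdd (hgc.comp (continuous_const.sub continuous_id)).aestronglyMeasurable
    (Eventually.of_forall fun t => by rw [Real.norm_eq_abs]; exact hgB _)

/-- `x ↦ ∫ f(t) g(x - t) dt` is Mathlib's convolution for the multiplication pairing. [folklore] -/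
private theorem conv_eq_convolution (f g : ℝ → ℝ) :
    (fun x => ∫ t, f t * g (x - t)) = f ⋆[ContinuousLinearMap.mul ℝ ℝ, volume] g := by
  funext x
  rw [convolution_def]
  simp only [ContinuousLinearMap.mul_apply']

/-- `x ↦ ∫ f(t) g(x - t) dt` is continuous for `f ∈ L¹`, `g` bounded continuous. [folklore] -/
private theorem continuous_conv (hf : Integrable f) (hgc : Continuous g) (hgB : ∀ y, |g y| ≤ B) :
    Continuous fun x => ∫ t, f t * g (x - t) := by
  rw [conv_eq_convolution]
  refine BddAbove.continuous_convolution_right_of_integrable (L := ContinuousLinearMap.mul ℝ ℝ)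
    ⟨B, ?_⟩ hf hgc
  rintro _ ⟨y, rfl⟩
  exact (Real.norm_eq_abs _).trans_le (hgB y)

/-- `∫∫ f(t) g(x - t) dt dx = (∫ f)(∫ g)` for `f, g ∈ L¹`, and the convolution is integrable. [folklore] -/
private theorem integrable_conv_and_integral (hf : Integrable f) (hg : Integrable g) :
    Integrable (fun x => ∫ t, f t * g (x - t)) ∧
      ∫ x, ∫ t, f t * g (x - t) = (∫ t, f t) * ∫ y, g y := by
  rw [conv_eq_convolution]
  exact ⟨hf.integrable_convolution _ hg, by
    rw [integral_convolution (L := ContinuousLinearMap.mul ℝ ℝ) hf hg]; rfl⟩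

/-- `0 ≤ ∫ f(t) g(x - t) dt ≤ B ∫ f` for `f, g ≥ 0`, `g ≤ B`, `f ∈ L¹`. [folklore] -/
private theorem conv_nonneg_le (hf : Integrable f) (hf0 : ∀ t, 0 ≤ f t) (hg0 : ∀ y, 0 ≤ g y)
    (hgB : ∀ y, g y ≤ B) (x : ℝ) :
    0 ≤ ∫ t, f t * g (x - t) ∧ ∫ t, f t * g (x - t) ≤ B * ∫ t, f t := by
  refine ⟨integral_nonneg fun t => mul_nonneg (hf0 t) (hg0 _), ?_⟩
  rw [← MeasureTheory.integral_const_mul]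
  refine integral_mono_of_nonneg (Eventually.of_forall fun t => mul_nonneg (hf0 t) (hg0 _))
    (hf.const_mul B) (Eventually.of_forall fun t => ?_)
  dsimp only
  rw [mul_comm B]
  exact mul_le_mul_of_nonneg_left (hgB _) (hf0 t)

end LiebWuNeumann

open LiebWuNeumann

/-- The source term **`ξ = R̂(Â + D̂)t`** of Lieb–Wu's eq. (S) at `B = ∞`, in the original variables:
`ξ(Λ) = (1/4π) ∫_{-Q}^{Q} r_{U/4}(Λ - sin k) dk` (`R̂` has kernel `r/2`; `(Â + D̂)t dx` is the image of
`dk/2π` on `[-Q, Q]` under `x = sin k`). [cite: LiebWuPhysicaA2003, §5, eq. (S)] -/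
def liebWuXi (U Q Λ : ℝ) : ℝ :=
  1 / (4 * π) * ∫ k in -Q..Q, sechKernel (U / 4) (Λ - Real.sin k)

/-- The operator **`Ŵ = R̂ÂK̂`** of Lieb–Wu's eq. (W) at `B = ∞` (`B̂ = 1`), in kernel form:
`(Ŵh)(x) = ½ ∫ 1_{(-a,a]}(y) (∫ h(t) K_{U/4}(y - t) dt) r_{U/4}(x - y) dy`, `a = sin Q`.
[cite: LiebWuPhysicaA2003, §5, eq. (W)] -/
def liebWuW (U Q : ℝ) (h : ℝ → ℝ) (x : ℝ) : ℝ :=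
  1 / 2 * ∫ y, ((Ioc (-Real.sin Q) (Real.sin Q)).indicator (fun _ => (1 : ℝ)) y *
    ∫ t, h t * cauchyDensity (U / 4) (y - t)) * sechKernel (U / 4) (x - y)

/-- The Neumann terms `Ŵⁿ ξ`. [cite: LiebWuPhysicaA2003, §5, eq. (series)] -/
def liebWuNeumannTerm (U Q : ℝ) : ℕ → ℝ → ℝ
  | 0 => liebWuXi U Q
  | n + 1 => liebWuW U Q (liebWuNeumannTerm U Q n)

/-- **`σ = (1 + Ŵ + Ŵ² + …) ξ`**, the Neumann-series solution of eq. (S) at `B = ∞`.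
[cite: LiebWuPhysicaA2003, §5, eq. (series)] -/
def liebWuSigmaAt (U Q Λ : ℝ) : ℝ :=
  ∑' n, liebWuNeumannTerm U Q n Λ

variable {U Q : ℝ} {h : ℝ → ℝ}

/-- `ξ` is continuous. [cite: LiebWuPhysicaA2003, §5, eq. (S)] -/
theorem continuous_liebWuXi (hU : 0 < U) (Q : ℝ) : Continuous (liebWuXi U Q) := by
  have hc : 0 < U / 4 := by positivity
  refine continuous_const.mul (intervalIntegral.continuous_parametric_intervalIntegral_of_continuous'
    (μ := volume) ?_ _ _)
  exact (continuous_sechKernel hc).comp (continuous_fst.sub (Real.continuous_sin.comp continuous_snd))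

/-- `0 < ξ` for `Q > 0` (the kernel of `R̂` is positive). [cite: LiebWuPhysicaA2003, §5, proof of Theorem 1] -/
theorem liebWuXi_pos (hU : 0 < U) (hQ : 0 < Q) (Λ : ℝ) : 0 < liebWuXi U Q Λ := by
  have hc : 0 < U / 4 := by positivity
  unfold liebWuXi
  refine mul_pos (by positivity) (intervalIntegral.intervalIntegral_pos_of_pos
    (((continuous_sechKernel hc).comp (continuous_const.sub Real.continuous_sin)).intervalIntegrable _ _)
    (fun k => sechKernel_pos hc _) (by linarith))

/-- `ξ ≤ Q/(4πc)`, `c = U/4` (`r ≤ 1/(2c)`). [cite: LiebWuPhysicaA2003, §5, eq. (S)] -/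
theorem liebWuXi_le (hU : 0 < U) (hQ : 0 < Q) (Λ : ℝ) :
    liebWuXi U Q Λ ≤ 1 / (4 * π) * ((1 / (2 * (U / 4))) * (Q - -Q)) := by
  have hc : 0 < U / 4 := by positivity
  unfold liebWuXi
  refine mul_le_mul_of_nonneg_left ?_ (by positivity)
  have h := intervalIntegral.integral_mono_on (by linarith : -Q ≤ Q)
    (((continuous_sechKernel hc).comp (continuous_const.sub Real.continuous_sin)).intervalIntegrable _ _)
    (intervalIntegrable_const : IntervalIntegrable (fun _ => (1 / (2 * (U / 4)) : ℝ)) volume (-Q) Q)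
    (fun k _ => sechKernel_le hc (Λ - Real.sin k))
  rwa [intervalIntegral.integral_const, smul_eq_mul, mul_comm] at h

/-- `ξ` as an integral against the finite measure `dk|_{(-Q,Q]}`. [cite: LiebWuPhysicaA2003, §5, eq. (S)] -/
theorem liebWuXi_eq_integral_restrict (hQ : 0 < Q) (U : ℝ) : liebWuXi U Q = fun Λ => 1 / (4 * π) *
      ∫ k, sechKernel (U / 4) (Λ - Real.sin k) ∂(volume.restrict (Ioc (-Q) Q)) :=
  funext fun Λ => by rw [liebWuXi, intervalIntegral.integral_of_le (by linarith)]

/-- `ξ ∈ L¹` with `∫ ξ = Q/(2π)` (`∫ r = 1`). [cite: LiebWuPhysicaA2003, §5, eq. (S)] -/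
theorem integrable_liebWuXi_and_integral (hU : 0 < U) (hQ : 0 < Q) :
    Integrable (liebWuXi U Q) ∧ ∫ Λ, liebWuXi U Q Λ = Q / (2 * π) := by
  have hc : 0 < U / 4 := by positivity
  rw [liebWuXi_eq_integral_restrict hQ]
  refine ⟨(integrable_integral_comp_sub (continuous_sechKernel hc) (integrable_sechKernel hc)
    Real.continuous_sin).const_mul _, ?_⟩
  beta_reduce
  rw [MeasureTheory.integral_const_mul, integral_integral_comp_sub (continuous_sechKernel hc)
    (integrable_sechKernel hc) Real.continuous_sin, integral_sechKernel hc, Measure.restrict_apply_univ,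
    Real.volume_Ioc, ENNReal.toReal_ofReal (by linarith)]
  field_simp
  ring

/-- **`Ŵ` preserves the cone of continuous nonnegative integrable functions, with
`∫ Ŵh ≤ ½ ∫ h` and `sup Ŵh ≤ (1/(4c)) ∫ h`**, `c = U/4` (since `∫K = ∫r = 1`, `0 ≤ 1_{(-a,a]} ≤ 1`,
`r ≤ 1/(2c)`): the `L¹`-bound is Lieb–Wu's "`‖Ŵ‖ < 1`". [cite: LiebWuPhysicaA2003, §5, proof of Theorem 1] -/
theorem liebWuW_props (hU : 0 < U) (hhi : Integrable h) (hh0 : ∀ t, 0 ≤ h t) :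
    Continuous (liebWuW U Q h) ∧ (∀ x, 0 ≤ liebWuW U Q h x) ∧ Integrable (liebWuW U Q h) ∧
      (∫ x, liebWuW U Q h x) ≤ 1 / 2 * ∫ t, h t ∧
      ∀ x, liebWuW U Q h x ≤ 1 / (4 * (U / 4)) * ∫ t, h t := by
  have hc : 0 < U / 4 := by positivity
  set a := Real.sin Q with ha
  set A : ℝ → ℝ := (Ioc (-a) a).indicator (fun _ => (1 : ℝ)) with hA
  have hA01 : ∀ y, 0 ≤ A y ∧ A y ≤ 1 := fun y => by
    by_cases hy : y ∈ Ioc (-a) a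
    · simp [hA, indicator_of_mem hy]
    · simp [hA, indicator_of_notMem hy]
  -- `G = h ∗ K`: continuous, `0 ≤ G ≤ (1/(πc)) ∫h`, integrable with `∫ G = ∫ h`
  set G : ℝ → ℝ := fun y => ∫ t, h t * cauchyDensity (U / 4) (y - t) with hG
  have hKB : ∀ y, |cauchyDensity (U / 4) y| ≤ 1 / (π * (U / 4)) := fun y => by
    rw [abs_of_pos (cauchyDensity_pos hc y)]; exact cauchyDensity_le hc y
  have hGc : Continuous G := continuous_conv hhi (continuous_cauchyDensity hc) hKB
  have hG0 : ∀ y, 0 ≤ G y := fun y =>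
    (conv_nonneg_le hhi hh0 (fun z => (cauchyDensity_pos hc z).le) (cauchyDensity_le hc) y).1
  obtain ⟨hGi, hGint⟩ := integrable_conv_and_integral hhi (integrable_cauchyDensity hc.le)
  rw [integral_cauchyDensity hc, mul_one] at hGint
  -- `F = A · G`: `0 ≤ F ≤ G`, integrable
  set F : ℝ → ℝ := fun y => A y * G y with hF
  have hF0 : ∀ y, 0 ≤ F y := fun y => mul_nonneg (hA01 y).1 (hG0 y)
  have hFle : ∀ y, F y ≤ G y := fun y => by
    have := mul_le_mul_of_nonneg_right (hA01 y).2 (hG0 y); rwa [one_mul] at this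
  have hFm : AEStronglyMeasurable F volume :=
    ((aestronglyMeasurable_const.indicator measurableSet_Ioc).mul hGc.aestronglyMeasurable)
  have hFi : Integrable F := hGi.mono' hFm (Eventually.of_forall fun y => by
    rw [Real.norm_eq_abs, abs_of_nonneg (hF0 y)]; exact hFle y)
  have hFint : ∫ y, F y ≤ ∫ t, h t := by rw [← hGint]; exact integral_mono hFi hGi hFle
  -- `Ŵh = ½ F ∗ r`
  have hrB : ∀ y, |sechKernel (U / 4) y| ≤ 1 / (2 * (U / 4)) := fun y => by
    rw [abs_of_pos (sechKernel_pos hc y)]; exact sechKernel_le hc y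
  have hW : liebWuW U Q h = fun x => 1 / 2 * ∫ y, F y * sechKernel (U / 4) (x - y) := by
    funext x; rw [liebWuW]
  obtain ⟨hFri, hFrint⟩ := integrable_conv_and_integral hFi (integrable_sechKernel hc)
  rw [integral_sechKernel hc, mul_one] at hFrint
  have hFr := fun x => conv_nonneg_le hFi hF0 (fun z => (sechKernel_pos hc z).le) (sechKernel_le hc) x
  refine ⟨?_, ?_, ?_, ?_, ?_⟩
  · rw [hW]; exact continuous_const.mul (continuous_conv hFi (continuous_sechKernel hc) hrB)
  · intro x; rw [hW]; exact mul_nonneg (by norm_num) (hFr x).1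
  · rw [hW]; exact hFri.const_mul _
  · rw [hW, MeasureTheory.integral_const_mul, hFrint]
    exact mul_le_mul_of_nonneg_left hFint (by norm_num)
  · intro x
    rw [hW]
    calc 1 / 2 * ∫ y, F y * sechKernel (U / 4) (x - y) ≤ 1 / 2 * (1 / (2 * (U / 4)) * ∫ y, F y) :=
          mul_le_mul_of_nonneg_left (hFr x).2 (by norm_num)
      _ ≤ 1 / 2 * (1 / (2 * (U / 4)) * ∫ t, h t) :=
          mul_le_mul_of_nonneg_left (mul_le_mul_of_nonneg_left hFint (by positivity)) (by norm_num)
      _ = 1 / (4 * (U / 4)) * ∫ t, h t := by ring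

/-- **Term-wise bounds**: each `Ŵⁿξ` is continuous, nonnegative, integrable, with
`∫ Ŵⁿξ ≤ 2⁻ⁿ ∫ξ`. [cite: LiebWuPhysicaA2003, §5, eq. (series)] -/
theorem liebWuNeumannTerm_props (hU : 0 < U) (hQ : 0 < Q) (n : ℕ) :
    Continuous (liebWuNeumannTerm U Q n) ∧ (∀ x, 0 ≤ liebWuNeumannTerm U Q n x) ∧
      Integrable (liebWuNeumannTerm U Q n) ∧
      (∫ x, liebWuNeumannTerm U Q n x) ≤ (1 / 2) ^ n * ∫ x, liebWuXi U Q x := by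
  induction n with
  | zero =>
    refine ⟨continuous_liebWuXi hU Q, fun x => (liebWuXi_pos hU hQ x).le,
      (integrable_liebWuXi_and_integral hU hQ).1, ?_⟩
    simp [liebWuNeumannTerm]
  | succ n ih =>
    obtain ⟨_, h0, hi, hint⟩ := ih
    obtain ⟨hc', h0', hi', hint', _⟩ := liebWuW_props (Q := Q) hU hi h0
    refine ⟨hc', h0', hi', ?_⟩
    calc (∫ x, liebWuNeumannTerm U Q (n + 1) x) = ∫ x, liebWuW U Q (liebWuNeumannTerm U Q n) x := rfl
      _ ≤ 1 / 2 * ∫ x, liebWuNeumannTerm U Q n x := hint'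
      _ ≤ 1 / 2 * ((1 / 2) ^ n * ∫ x, liebWuXi U Q x) := mul_le_mul_of_nonneg_left hint (by norm_num)
      _ = (1 / 2) ^ (n + 1) * ∫ x, liebWuXi U Q x := by ring

/-- **Uniform bound**: `Ŵⁿ⁺¹ξ(x) ≤ (1/U) 2⁻ⁿ ∫ξ`. [cite: LiebWuPhysicaA2003, §5, eq. (series)] -/
theorem liebWuNeumannTerm_succ_le (hU : 0 < U) (hQ : 0 < Q) (n : ℕ) (x : ℝ) :
    liebWuNeumannTerm U Q (n + 1) x ≤ 1 / (4 * (U / 4)) * ((1 / 2) ^ n * ∫ y, liebWuXi U Q y) := by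
  obtain ⟨_, h0, hi, hint⟩ := liebWuNeumannTerm_props hU hQ n
  obtain ⟨_, _, _, _, hsup⟩ := liebWuW_props (Q := Q) hU hi h0
  exact (hsup x).trans (mul_le_mul_of_nonneg_left hint (by positivity))

/-- The summable majorant of the Neumann terms: `‖Ŵⁿξ‖ ≤ 2(M₀ + M₁) 2⁻ⁿ` with `M₀ = Q/(4πc)` (bound of
`ξ`) and `M₁ = (1/(4c)) ∫ξ`. [cite: LiebWuPhysicaA2003, §5, eq. (series)] -/
theorem liebWuNeumannTerm_le_majorant (hU : 0 < U) (hQ : 0 < Q) (n : ℕ) (x : ℝ) :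
    ‖liebWuNeumannTerm U Q n x‖ ≤
      2 * (1 / (4 * π) * ((1 / (2 * (U / 4))) * (Q - -Q)) + 1 / (4 * (U / 4)) * ∫ y, liebWuXi U Q y) *
        (1 / 2) ^ n := by
  have hI : 0 ≤ ∫ y, liebWuXi U Q y := integral_nonneg fun y => (liebWuXi_pos hU hQ y).le
  have hM0 : 0 ≤ 1 / (4 * π) * ((1 / (2 * (U / 4))) * (Q - -Q)) := by
    have : 0 ≤ Q - -Q := by linarith
    positivity
  have hM1 : 0 ≤ 1 / (4 * (U / 4)) * ∫ y, liebWuXi U Q y := by positivity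
  rw [Real.norm_eq_abs, abs_of_nonneg ((liebWuNeumannTerm_props hU hQ n).2.1 x)]
  cases n with
  | zero =>
    simp only [liebWuNeumannTerm, pow_zero, mul_one]
    linarith [liebWuXi_le hU hQ x]
  | succ n =>
    have hp : (0 : ℝ) ≤ (1 / 2) ^ n := by positivity
    calc liebWuNeumannTerm U Q (n + 1) x ≤ 1 / (4 * (U / 4)) * ((1 / 2) ^ n * ∫ y, liebWuXi U Q y) :=
          liebWuNeumannTerm_succ_le hU hQ n x
      _ = 2 * (1 / (4 * (U / 4)) * ∫ y, liebWuXi U Q y) * (1 / 2) ^ (n + 1) := by ring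
      _ ≤ _ := by
          rw [pow_succ]
          nlinarith [hM0, hM1, hp]

/-- **The Neumann series converges** (pointwise absolutely, uniformly): summability at every point.
[cite: LiebWuPhysicaA2003, §5, eq. (series)] -/
theorem summable_liebWuNeumannTerm (hU : 0 < U) (hQ : 0 < Q) (x : ℝ) :
    Summable fun n => liebWuNeumannTerm U Q n x :=
  Summable.of_norm_bounded ((summable_geometric_of_lt_one (by norm_num) (by norm_num)).mul_left _)
    (fun n => liebWuNeumannTerm_le_majorant hU hQ n x)

/-- **`σ` is continuous** (uniform convergence). [cite: LiebWuPhysicaA2003, §5, eq. (series)] -/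
theorem continuous_liebWuSigmaAt (hU : 0 < U) (hQ : 0 < Q) : Continuous (liebWuSigmaAt U Q) :=
  continuous_tsum (fun n => (liebWuNeumannTerm_props hU hQ n).1)
    ((summable_geometric_of_lt_one (by norm_num) (by norm_num)).mul_left _)
    (fun n x => liebWuNeumannTerm_le_majorant hU hQ n x)

/-- **`σ > 0`** ("since each term is a positive function, `σ` is a positive function as well"; indeed
`σ ≥ ξ > 0`). [cite: LiebWuPhysicaA2003, §5, Theorem 1] -/
theorem liebWuSigmaAt_pos (hU : 0 < U) (hQ : 0 < Q) (x : ℝ) : 0 < liebWuSigmaAt U Q x := by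
  rw [liebWuSigmaAt, (summable_liebWuNeumannTerm hU hQ x).tsum_eq_zero_add]
  exact add_pos_of_pos_of_nonneg (liebWuXi_pos hU hQ x)
    (tsum_nonneg fun n => (liebWuNeumannTerm_props hU hQ (n + 1)).2.1 x)

/-- The integrals of the terms are summable (`≤ Σ 2⁻ⁿ ∫ξ`). [cite: LiebWuPhysicaA2003, §5, eq. (series)] -/
theorem summable_integral_liebWuNeumannTerm (hU : 0 < U) (hQ : 0 < Q) :
    Summable fun n => ∫ x, ‖liebWuNeumannTerm U Q n x‖ := by
  have hI : 0 ≤ ∫ y, liebWuXi U Q y := integral_nonneg fun y => (liebWuXi_pos hU hQ y).le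
  refine Summable.of_nonneg_of_le (fun n => integral_nonneg fun x => norm_nonneg _) (fun n => ?_)
    ((summable_geometric_of_lt_one (by norm_num : (0 : ℝ) ≤ 1 / 2) (by norm_num)).mul_right
      (∫ x, liebWuXi U Q x))
  have h := (liebWuNeumannTerm_props hU hQ n)
  calc ∫ x, ‖liebWuNeumannTerm U Q n x‖ = ∫ x, liebWuNeumannTerm U Q n x :=
        integral_congr_ae (Eventually.of_forall fun x => Real.norm_of_nonneg (h.2.1 x))
    _ ≤ (1 / 2) ^ n * ∫ x, liebWuXi U Q x := h.2.2.2

/-- **`σ ∈ L¹`** with `∫σ = Σ ∫Ŵⁿξ ≤ 2∫ξ = Q/π`. [cite: LiebWuPhysicaA2003, §5, eq. (series)] -/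
theorem integrable_liebWuSigmaAt (hU : 0 < U) (hQ : 0 < Q) : Integrable (liebWuSigmaAt U Q) := by
  have hprops := liebWuNeumannTerm_props hU hQ
  have hsum := summable_integral_liebWuNeumannTerm hU hQ
  have hσ0 : ∀ x, 0 ≤ liebWuSigmaAt U Q x := fun x => (liebWuSigmaAt_pos hU hQ x).le
  refine (lintegral_ofReal_ne_top_iff_integrable (continuous_liebWuSigmaAt hU hQ).aestronglyMeasurable
    (Eventually.of_forall hσ0)).1 ?_
  have h1 : ∀ x, ENNReal.ofReal (liebWuSigmaAt U Q x) =
      ∑' n, ENNReal.ofReal (liebWuNeumannTerm U Q n x) := fun x =>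
    ENNReal.ofReal_tsum_of_nonneg (fun n => (hprops n).2.1 x) (summable_liebWuNeumannTerm hU hQ x)
  simp_rw [h1]
  rw [lintegral_tsum fun n => (hprops n).1.measurable.ennreal_ofReal.aemeasurable]
  have h2 : ∀ n, ∫⁻ x, ENNReal.ofReal (liebWuNeumannTerm U Q n x) =
      ENNReal.ofReal (∫ x, ‖liebWuNeumannTerm U Q n x‖) := fun n => by
    rw [← ofReal_integral_eq_lintegral_ofReal (hprops n).2.2.1 (Eventually.of_forall (hprops n).2.1)]
    congr 1
    exact integral_congr_ae (Eventually.of_forall fun x => (Real.norm_of_nonneg ((hprops n).2.1 x)).symm)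
  simp_rw [h2]
  rw [← ENNReal.ofReal_tsum_of_nonneg (fun n => integral_nonneg fun x => norm_nonneg _) hsum]
  exact ENNReal.ofReal_ne_top

/-- **The fixed-point equation (S) at `B = ∞`: `σ = ξ + Ŵσ`** — the Neumann series solves
`(1 - Ŵ)σ = ξ` (term-wise: `Ŵ` is an integral operator with a bounded kernel, so it passes through the
`L¹`-convergent sum). [cite: LiebWuPhysicaA2003, §5, eqs. (S), (series)] -/
theorem liebWuSigmaAt_eq_xi_add_W (hU : 0 < U) (hQ : 0 < Q) (x : ℝ) :
    liebWuSigmaAt U Q x = liebWuXi U Q x + liebWuW U Q (liebWuSigmaAt U Q) x := by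
  have hc : 0 < U / 4 := by positivity
  have hprops := liebWuNeumannTerm_props hU hQ
  have hsumI := summable_integral_liebWuNeumannTerm hU hQ
  set A : ℝ → ℝ := (Ioc (-Real.sin Q) (Real.sin Q)).indicator (fun _ => (1 : ℝ)) with hA
  have hA1 : ∀ y, |A y| ≤ 1 := fun y => by
    by_cases hy : y ∈ Ioc (-Real.sin Q) (Real.sin Q)
    · simp [hA, indicator_of_mem hy]
    · simp [hA, indicator_of_notMem hy]
  have hAm : AEStronglyMeasurable A volume := aestronglyMeasurable_const.indicator measurableSet_Ioc
  -- inner sum: `(σ ∗ K)(y) = Σ (Ŵⁿξ ∗ K)(y)`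
  have hinner : ∀ y, ∫ t, liebWuSigmaAt U Q t * cauchyDensity (U / 4) (y - t) =
      ∑' n, ∫ t, liebWuNeumannTerm U Q n t * cauchyDensity (U / 4) (y - t) := by
    intro y
    have hKB : ∀ z, |cauchyDensity (U / 4) z| ≤ 1 / (π * (U / 4)) := fun z => by
      rw [abs_of_pos (cauchyDensity_pos hc z)]; exact cauchyDensity_le hc z
    rw [integral_tsum_of_summable_integral_norm (fun n => integrable_mul_sub (hprops n).2.2.1
      (continuous_cauchyDensity hc) hKB y) ?_]
    · simp only [liebWuSigmaAt]
      refine integral_congr_ae (Eventually.of_forall fun t => ?_)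
      exact (tsum_mul_right).symm
    · refine Summable.of_nonneg_of_le (fun n => integral_nonneg fun t => norm_nonneg _) (fun n => ?_)
        (hsumI.mul_right (1 / (π * (U / 4))))
      rw [← MeasureTheory.integral_mul_const]
      refine integral_mono ((integrable_mul_sub (hprops n).2.2.1 (continuous_cauchyDensity hc) hKB y).norm)
        ((hprops n).2.2.1.norm.mul_const _) fun t => ?_
      dsimp only
      rw [norm_mul]
      exact mul_le_mul_of_nonneg_left (by rw [Real.norm_eq_abs]; exact hKB _) (norm_nonneg _)
  -- outer sum
  have hterm : ∀ n, Integrable fun y => A y * (∫ t, liebWuNeumannTerm U Q n t *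
      cauchyDensity (U / 4) (y - t)) * sechKernel (U / 4) (x - y) := by
    intro n
    obtain ⟨hGi, _⟩ := integrable_conv_and_integral (hprops n).2.2.1 (integrable_cauchyDensity hc.le)
    have h1 : Integrable fun y => A y * ∫ t, liebWuNeumannTerm U Q n t * cauchyDensity (U / 4) (y - t) :=
      hGi.bdd_mul hAm (Eventually.of_forall fun y => by rw [Real.norm_eq_abs]; exact hA1 y)
    exact h1.mul_bdd ((continuous_sechKernel hc).comp (continuous_const.sub continuous_id)).aestronglyMeasurable
      (Eventually.of_forall fun y => by
        rw [Real.norm_eq_abs, abs_of_pos (sechKernel_pos hc _)]; exact sechKernel_le hc _)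
  have houter : ∫ y, A y * (∫ t, liebWuSigmaAt U Q t * cauchyDensity (U / 4) (y - t)) *
      sechKernel (U / 4) (x - y) = ∑' n, ∫ y, A y * (∫ t, liebWuNeumannTerm U Q n t *
        cauchyDensity (U / 4) (y - t)) * sechKernel (U / 4) (x - y) := by
    rw [integral_tsum_of_summable_integral_norm hterm ?_]
    · refine integral_congr_ae (Eventually.of_forall fun y => ?_)
      beta_reduce
      rw [hinner y, ← tsum_mul_left, ← tsum_mul_right]
    · -- `∫ |A (hₙ ∗ K) r(x - ·)| ≤ (1/(2c)) ∫ (hₙ ∗ K) = (1/(2c)) ∫ hₙ`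
      refine Summable.of_nonneg_of_le (fun n => integral_nonneg fun t => norm_nonneg _) (fun n => ?_)
        (hsumI.mul_right (1 / (2 * (U / 4))))
      obtain ⟨hGi, hGint⟩ := integrable_conv_and_integral (hprops n).2.2.1 (integrable_cauchyDensity hc.le)
      rw [integral_cauchyDensity hc, mul_one] at hGint
      have hG0 : ∀ y, 0 ≤ ∫ t, liebWuNeumannTerm U Q n t * cauchyDensity (U / 4) (y - t) := fun y =>
        integral_nonneg fun t => mul_nonneg ((hprops n).2.1 t) (cauchyDensity_pos hc _).le
      have hn : ∫ x, ‖liebWuNeumannTerm U Q n x‖ = ∫ x, liebWuNeumannTerm U Q n x :=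
        integral_congr_ae (Eventually.of_forall fun x => Real.norm_of_nonneg ((hprops n).2.1 x))
      rw [hn, ← hGint, ← MeasureTheory.integral_mul_const]
      refine integral_mono (hterm n).norm (hGi.mul_const _) fun y => ?_
      dsimp only
      rw [norm_mul, norm_mul, Real.norm_eq_abs, Real.norm_eq_abs, Real.norm_eq_abs, abs_of_nonneg (hG0 y),
        abs_of_pos (sechKernel_pos hc _)]
      calc |A y| * (∫ t, liebWuNeumannTerm U Q n t * cauchyDensity (U / 4) (y - t)) * sechKernel (U / 4) (x - y)
          ≤ 1 * (∫ t, liebWuNeumannTerm U Q n t * cauchyDensity (U / 4) (y - t)) * (1 / (2 * (U / 4))) :=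
            mul_le_mul (mul_le_mul_of_nonneg_right (hA1 y) (hG0 y)) (sechKernel_le hc _)
              (sechKernel_pos hc _).le (mul_nonneg zero_le_one (hG0 y))
        _ = _ := by rw [one_mul]
  -- assemble: `ξ + Ŵσ = ξ + Σ Ŵ(Ŵⁿξ) = Σ Ŵⁿξ`
  have hWσ : liebWuW U Q (liebWuSigmaAt U Q) x = ∑' n, liebWuNeumannTerm U Q (n + 1) x := by
    rw [liebWuW, houter, ← tsum_mul_left]
    rfl
  rw [hWσ, liebWuSigmaAt, (summable_liebWuNeumannTerm hU hQ x).tsum_eq_zero_add]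
  rfl

end Literature.MathematicalPhysics.QuantumLattice

end
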